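import Literature.AlgebraicGeometry.HodgeTheory.AbelianVarietyHodgeFullnessOfUniformisation
import Literature.AlgebraicGeometry.HodgeTheory.DirectImageTransportInclusion
import HarnessLib

/-!
# Coordinates of flat classes in a flat frame are fixed functionals; lattice coordinates through a uniformisation

Topic `AlgebraicGeometry/HodgeTheory`; namespace `Literature.AlgebraicGeometry.HodgeTheory`.  KERNEL ONLY: theorems;
no definition, no named fact, no instance, no `sorry`.  Cell `hodgecm-mathlib` (D-0151),
rung-0 (U)-road, node U-e P4, PLAN v0.6 (B-p03 (g13)) seam **(S-4) «flat-frame coordinates»** of the (B1b) step: the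
holomorphy of the period point `π(t) = Δ · P(t)_μ⁻¹ · P(t)_λ` of a family of marked abelian varieties is read off the
COORDINATE MATRIX `P(t)` of a holomorphic Hodge frame `wᵢ(t)` (Griffiths) in the CANONICAL LATTICE COORDINATES of the
markings (★ `latticeCoordHOne`, [LangeBirkenhake1992] Lemma 1.1.17 (a): `H¹(X, ℤ) = Hom(Λ, ℤ)`), and one must know that
`t ↦ P(t) i a` is, for each `(i, a)`, a FIXED linear functional of the frame vector `wᵢ(t) ∈ ℂ ⊗ Hᵏ(X_{t₁}; ℚ)` (then it
is holomorphic because the frame is).  This holds because (1) the lattice frame `γ_t` of the markings is FLAT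
(parallel transport carries `γ_{t₁}` to `γ_t`, [VoisinHodgeI2002] §9.2.1: `R¹f_*ℤ` is a local system) and (2) the lattice
coordinates through the uniformisation `u_t : ℂ^g/Λ → X_t(ℂ)` ARE the coordinates in the basis `γ_t`
(`u_t^* γ_t = ξ`, the canonical classes).  Pure linear algebra + the tree's transport bookkeeping:

* §1 `LinearMap.comp_equiv_eq_equivFun_of_frame` — if `T` maps the basis `b` to a family `c` and `L` reads `c` as the
  standard vectors, then `L ∘ T = b.equivFun` (coordinates are transported); `piScalarRight_baseChange_comp_of_frame`
  — the complexified coordinate `a` of `T_ℂ w` read by `L_ℂ` is the FIXED functional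
  `(piScalarRight · a) ∘ (b.equivFun ⊗ ℂ)` of `w`.
* §2 `exists_basis_of_latticeFrame`, `latticeCoordHOne_map_frame`, `LinearMap.eq_of_frame` — for a homeomorphism
  `u : ℂ^g/Φ(ℤ^ι) ≃ₜ Y` and classes `γₐ ∈ H¹(Y; ℚ)` with `u^* γₐ = ξₐ` (★ `latticeClass`), `γ` is a basis of
  `H¹(Y; ℚ)` and `latticeCoordHOne Φ ∘ u^*` reads it as the standard vectors (★ `latticeCoordHOne_latticeClass`), so
  any two such readings agree.
* §3 `ratTransport_apply_flatFrame` — for a family `π : 𝒳 → S` cohomologically locally trivial over `S(ℂ)` and over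
  `W ⊆ S(ℂ)`, a frame `γ` over `W` FLAT for transport in `W` (clause (iii) of the (N1) notion `IsFlatIntegralFrame`),
  and a rational transport `T` along a path `ε` of `S(ℂ)` staying in `W` (the shape delivered by Griffiths' theorem ★
  `griffiths1968_holomorphicHodgeSubbundlesQP…` / ★ `exists_ratTransport`): `T (γ_s a) = γ_t a` (★
  `transportFun_map_inclusion_univ`, `ofRatClass` injective).
* §4 HEAD `latticeCoord_transport_eq_fixedFunctional` — (S-4) assembled: with `u_t`, `γ`, `T` as above and ANY
  `w ∈ ℂ ⊗ H¹(X_s; ℚ)`, the lattice coordinate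
  `piScalarRight (((latticeCoordHOne Φ ∘ φ^*) ⊗ ℂ) ((e^* ⊗ ℂ)(T_ℂ w))) a` (`u_t = e ∘ φ`, the spelling of ★
  `siegelPoint_eq_of_hodgeFrame_of_apply_jOfSiegel`'s `hP` fed with ★ `hodgeFrame_transport_of_iso`'s frame) equals
  `Λ_a w` for the fixed functional `Λ_a := (piScalarRight · a) ∘ ((latticeCoordHOne Φ_s ∘ u_s^*) ⊗ ℂ)` — the lattice
  coordinates AT THE REFERENCE FIBRE `s` of the un-transported class.

PRINT. [LangeBirkenhake1992] Ch. 8 §8.1 (period matrices of a family of marked abelian varieties in a symplectic basis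
of the LOCALLY CONSTANT lattice), §1.1.3 Lemma 1.1.17 (a); [VoisinHodgeI2002] §9.2.1 (local systems and flat
sections), §10.1.2–§10.2.1 (the period map: Hodge filtration read against a flat frame).  HC_CM is proved only modulo
the 7 printed citations until rung 0 closes; nothing here changes that count (books 0).

## References
* [LangeBirkenhake1992] H. Lange, Ch. Birkenhake, *Complex Abelian Varieties* (1992), §1.1.3 Lemma 1.1.17 (a), Ch. 8 §8.1.
* [Lange2023AbelianVarietiesComplex] H. Lange, *Abelian Varieties over the Complex Numbers* (2023), §1.1.3 Lemma 1.1.17 (a) (p. 14).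
* [VoisinHodgeI2002] C. Voisin, *Hodge Theory and Complex Algebraic Geometry I* (2002), §9.2.1, §10.2.1.
* [HatcherAT2002] A. Hatcher, *Algebraic Topology* (2002), §3.1.
-/

set_option autoImplicit false

noncomputable section

open scoped TensorProduct
open CategoryTheory
open Literature.AlgebraicTopology.SingularHomology
open Literature.AlgebraicGeometry.Motives (ComplexPoints fiberOver)
open Literature.Geometry.Kaehler (ComplexTorus)

universe u

namespace Literature.AlgebraicGeometry.HodgeTheory

/-! ### §1 Coordinates are transported with the frame -/

section LinearAlgebra

variable {ι : Type*} [Fintype ι] [DecidableEq ι] {V V' : Type*} [AddCommGroup V] [Module ℚ V]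
  [AddCommGroup V'] [Module ℚ V']

/-- **Coordinates are transported with the frame**: if `T : V ≃ V'` maps a basis `b` of `V` to the family `c` and the
linear reading `L : V' → ℚ^ι` sends `c a` to the standard vector `e_a`, then `L ∘ T` IS the coordinate map of `b`.
[cite: LangeBirkenhake1992, Ch. 8 §8.1] -/
theorem LinearMap.comp_equiv_eq_equivFun_of_frame (b : Module.Basis ι ℚ V) {c : ι → V'} (T : V ≃ₗ[ℚ] V')
    (hT : ∀ a, T (b a) = c a) (L : V' →ₗ[ℚ] (ι → ℚ)) (hL : ∀ a, L (c a) = Pi.single a 1) :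
    L ∘ₗ (T : V →ₗ[ℚ] V') = (b.equivFun : V →ₗ[ℚ] (ι → ℚ)) := by
  refine b.ext fun a ↦ ?_
  rw [LinearMap.comp_apply, LinearEquiv.coe_coe, hT, hL, LinearEquiv.coe_coe, Module.Basis.equivFun_apply,
    Module.Basis.repr_self, Finsupp.single_eq_pi_single]

/-- **The complexified coordinate is a fixed functional of the un-transported vector**: under the hypotheses of
`LinearMap.comp_equiv_eq_equivFun_of_frame`, for every `w ∈ ℂ ⊗ V` and `a`,
`((L ⊗ ℂ) ((T ⊗ ℂ) w))_a = ((b.equivFun ⊗ ℂ) w)_a`. [cite: LangeBirkenhake1992, Ch. 8 §8.1] -/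
theorem piScalarRight_baseChange_comp_of_frame (b : Module.Basis ι ℚ V) {c : ι → V'} (T : V ≃ₗ[ℚ] V')
    (hT : ∀ a, T (b a) = c a) (L : V' →ₗ[ℚ] (ι → ℚ)) (hL : ∀ a, L (c a) = Pi.single a 1)
    (w : ℂ ⊗[ℚ] V) (a : ι) :
    TensorProduct.piScalarRight ℚ ℂ ℂ ι (L.baseChange ℂ (T.toLinearMap.baseChange ℂ w)) a =
      TensorProduct.piScalarRight ℚ ℂ ℂ ι ((b.equivFun : V →ₗ[ℚ] (ι → ℚ)).baseChange ℂ w) a := by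
  rw [← LinearMap.comp_equiv_eq_equivFun_of_frame b T hT L hL, LinearMap.baseChange_comp,
    LinearMap.comp_apply]

end LinearAlgebra

/-! ### §2 Lattice coordinates through a uniformisation are coordinates in the lattice frame -/

section Lattice

variable {ι : Type} [Fintype ι] {E : Type} [NormedAddCommGroup E] [NormedSpace ℂ E]
  [FiniteDimensional ℂ E] (Φ : (ι → ℝ) ≃L[ℝ] E) {Y : Type} [TopologicalSpace Y]

/-- **The lattice frame read through a uniformisation is a basis**: for a homeomorphism `u : ℂ^g/Φ(ℤ^ι) ≃ₜ Y` and
classes `γₐ ∈ H¹(Y; ℚ)` with `u^* γₐ = ξₐ` (the canonical lattice classes, ★ `latticeBasisHOne`), `γ` is a basis of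
`H¹(Y; ℚ)` — namely `(u^*)⁻¹ ξ` (`u^*` is an isomorphism, ★ `singularCohomology.mapIso`).
[cite: Lange2023AbelianVarietiesComplex, §1.1.3 Lemma 1.1.17 (a) (p. 14)] -/
theorem exists_basis_of_latticeFrame (u : ComplexTorus Φ ≃ₜ Y) (γ : ι → singularCohomology ℚ ℚ Y 1)
    (hγ : ∀ a, singularCohomology.map ℚ ℚ (u : C(ComplexTorus Φ, Y)) 1 (γ a) = latticeClass Φ a) :
    ∃ b : Module.Basis ι ℚ (singularCohomology ℚ ℚ Y 1), ⇑b = γ := by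
  refine ⟨(latticeBasisHOne Φ).map (singularCohomology.mapIso (R := ℚ) (M := ℚ) u 1).toLinearEquiv.symm, ?_⟩
  funext a
  rw [Module.Basis.map_apply, latticeBasisHOne_apply, LinearEquiv.symm_apply_eq]
  exact (hγ a).symm

/-- The reading `latticeCoordHOne Φ ∘ u^*` sends `γₐ` to `eₐ` when `u^* γₐ = ξₐ` (★ `latticeCoordHOne_latticeClass`).
[cite: Lange2023AbelianVarietiesComplex, §1.1.3 Lemma 1.1.17 (a) (p. 14)] -/
theorem latticeCoordHOne_map_frame [DecidableEq ι] (u : C(ComplexTorus Φ, Y)) (γ : ι → singularCohomology ℚ ℚ Y 1)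
    (hγ : ∀ a, singularCohomology.map ℚ ℚ u 1 (γ a) = latticeClass Φ a) (a : ι) :
    ((latticeCoordHOne Φ).toLinearMap ∘ₗ (singularCohomology.map ℚ ℚ u 1).hom) (γ a) = Pi.single a 1 := by
  rw [LinearMap.comp_apply, LinearEquiv.coe_coe, hγ, latticeCoordHOne_latticeClass]

omit [Fintype ι] in
/-- **Two lattice readings of one frame agree**: if `γ` is a basis read as the standard vectors by two linear maps
`L`, `L'` (e.g. `latticeCoordHOne Φ ∘ u^*` for two uniformisations framing `γ`), then `L = L'`.
[cite: Lange2023AbelianVarietiesComplex, §1.1.3 Lemma 1.1.17 (a) (p. 14)] -/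
theorem LinearMap.eq_of_frame [DecidableEq ι] {V : Type*} [AddCommGroup V] [Module ℚ V] (b : Module.Basis ι ℚ V)
    (L L' : V →ₗ[ℚ] (ι → ℚ)) (hL : ∀ a, L (b a) = Pi.single a 1) (hL' : ∀ a, L' (b a) = Pi.single a 1) :
    L = L' :=
  b.ext fun a ↦ by rw [hL, hL']

end Lattice

/-! ### §3 A rational transport along a path staying in `W` maps a `W`-flat frame to itself -/

section Transport

variable {𝒳 S : Motives.SchemeOver ℂ} (π : 𝒳 ⟶ S) (k : ℕ)
  (hU : IsCohomologicallyLocallyTrivialOn π (Set.univ : Set (ComplexPoints S)))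
  {W : Set (ComplexPoints S)} (hW : IsCohomologicallyLocallyTrivialOn π W)

/-- **A rational transport along a path staying in `W` maps a `W`-flat frame to itself.**  Let `γ_x`, `x ∈ W`, be
classes of `Hᵏ(X_x(ℂ); ℚ)` FLAT for transport inside `W` (clause (iii) of the (N1) notion: transport along every
homotopy class of paths of `W` carries `γ_x a ⊗ 1` to `γ_{x'} a ⊗ 1`), and let `T : Hᵏ(X_s; ℚ) ≃ Hᵏ(X_t; ℚ)` be a rational
transport along a path `ε` of `S(ℂ)` with image in `W` (`(T v) ⊗ 1 = ε_* (v ⊗ 1)`, transport for the family over ALL of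
`S(ℂ)`).  Then `T (γ_s a) = γ_t a` (transport over `univ` along `ε` = transport over `W` along `ε`, ★
`transportFun_map_inclusion_univ`; `ofRatClass` is injective). [cite: VoisinHodgeI2002, §9.2.1] -/
theorem ratTransport_apply_flatFrame {ι : Type*}
    (γ : ∀ x : W, ι → singularCohomology ℚ ℚ (ComplexPoints (fiberOver π x.1)) k)
    (hflat : ∀ (x x' : W) (p : Path.Homotopic.Quotient x x') (a : ι),
      transportFun π k hW p (ofRatClass _ k (γ x a)) = ofRatClass _ k (γ x' a))
    {s t : (Set.univ : Set (ComplexPoints S))} (hs : s.1 ∈ W) (ht : t.1 ∈ W) (ε : Path s t)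
    (hε : ∀ r, (ε r).1 ∈ W)
    (T : singularCohomology ℚ ℚ (ComplexPoints (fiberOver π s.1)) k ≃ₗ[ℚ]
      singularCohomology ℚ ℚ (ComplexPoints (fiberOver π t.1)) k)
    (hT : ∀ v, ofRatClass _ k (T v) = transportFun π k hU ⟦ε⟧ (ofRatClass _ k v)) (a : ι) :
    T (γ ⟨s.1, hs⟩ a) = γ ⟨t.1, ht⟩ a := by
  apply ofRatClass_injective k
  rw [hT]
  -- the path `ε`, as a path of `↥W`
  let εW : Path (⟨s.1, hs⟩ : W) ⟨t.1, ht⟩ :=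
    { toFun := fun r ↦ ⟨(ε r).1, hε r⟩
      continuous_toFun := (continuous_subtype_val.comp ε.continuous).subtype_mk _
      source' := Subtype.ext (show (ε 0).1 = s.1 from congrArg Subtype.val ε.source)
      target' := Subtype.ext (show (ε 1).1 = t.1 from congrArg Subtype.val ε.target) }
  have hpath : (⟦εW.map (continuous_inclusion (Set.subset_univ W))⟧ : Path.Homotopic.Quotient s t) = ⟦ε⟧ := by
    refine congrArg _ ?_
    ext r
    rfl
  have h := hflat ⟨s.1, hs⟩ ⟨t.1, ht⟩ ⟦εW⟧ a
  rw [← transportFun_map_inclusion_univ π k hW hU εW] at h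
  change transportFun π k hU (⟦ε⟧ : Path.Homotopic.Quotient s t) _ = _
  rw [← hpath]
  exact h

end Transport


/-! ### §4 HEAD: lattice coordinates of a transported class are fixed functionals of the class -/

section Head

variable {𝒳 S : Motives.SchemeOver ℂ} (π : 𝒳 ⟶ S)
  (hU : IsCohomologicallyLocallyTrivialOn π (Set.univ : Set (ComplexPoints S)))
  {W : Set (ComplexPoints S)} (hW : IsCohomologicallyLocallyTrivialOn π W)
  {ι : Type} [Fintype ι] [DecidableEq ι] {E : Type} [NormedAddCommGroup E] [NormedSpace ℂ E]
  [FiniteDimensional ℂ E]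

/-- **(S-4) LATTICE COORDINATES OF A TRANSPORTED CLASS ARE FIXED FUNCTIONALS.**  Family `π : 𝒳 → S` cohomologically
locally trivial over `S(ℂ)` and over `W`; a frame `γ_x ∈ H¹(X_x; ℚ)^ι` (`x ∈ W`) flat inside `W`; uniformisations
`u_s : ℂ^g/Φ_s(ℤ^ι) ≃ₜ X_s(ℂ)` and `u_t : ℂ^g/Φ_t(ℤ^ι) → X_t(ℂ)` through which `γ_s`, `γ_t` read as the canonical lattice
classes; a rational transport `T` along a path from `s` to `t` inside `W`.  Then for every `w ∈ ℂ ⊗ H¹(X_s; ℚ)` the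
`a`-th canonical lattice coordinate at `t` of the transported class `T_ℂ w` is `Λ_a w` for the FIXED functional
`Λ_a = (· )_a ∘ ((latticeCoordHOne Φ_s ∘ u_s^*) ⊗ ℂ)` (the lattice coordinates at the reference fibre) — in a family of marked abelian varieties the period matrix of a flat-transported
frame in the markings' symplectic lattice bases is read by constant functionals ([LangeBirkenhake1992] §8.1).
[cite: LangeBirkenhake1992, Ch. 8 §8.1] [cite: VoisinHodgeI2002, §9.2.1] -/
theorem latticeCoord_transport_eq_fixedFunctional
    (γ : ∀ x : W, ι → singularCohomology ℚ ℚ (ComplexPoints (fiberOver π x.1)) 1)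
    (hflat : ∀ (x x' : W) (p : Path.Homotopic.Quotient x x') (a : ι),
      transportFun π 1 hW p (ofRatClass _ 1 (γ x a)) = ofRatClass _ 1 (γ x' a))
    {s t : (Set.univ : Set (ComplexPoints S))} (hs : s.1 ∈ W) (ht : t.1 ∈ W) (ε : Path s t)
    (hε : ∀ r, (ε r).1 ∈ W)
    (T : singularCohomology ℚ ℚ (ComplexPoints (fiberOver π s.1)) 1 ≃ₗ[ℚ]
      singularCohomology ℚ ℚ (ComplexPoints (fiberOver π t.1)) 1)
    (hT : ∀ v, ofRatClass _ 1 (T v) = transportFun π 1 hU ⟦ε⟧ (ofRatClass _ 1 v))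
    {Φs Φt : (ι → ℝ) ≃L[ℝ] E} (us : ComplexTorus Φs ≃ₜ ComplexPoints (fiberOver π s.1))
    (hus : ∀ a, singularCohomology.map ℚ ℚ (us : C(ComplexTorus Φs, ComplexPoints (fiberOver π s.1))) 1
      (γ ⟨s.1, hs⟩ a) = latticeClass Φs a)
    (ut : C(ComplexTorus Φt, ComplexPoints (fiberOver π t.1)))
    (hut : ∀ a, singularCohomology.map ℚ ℚ ut 1 (γ ⟨t.1, ht⟩ a) = latticeClass Φt a)
    (w : ℂ ⊗[ℚ] singularCohomology ℚ ℚ (ComplexPoints (fiberOver π s.1)) 1) (a : ι) :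
    TensorProduct.piScalarRight ℚ ℂ ℂ ι
        (((latticeCoordHOne Φt).toLinearMap ∘ₗ (singularCohomology.map ℚ ℚ ut 1).hom).baseChange ℂ
          (T.toLinearMap.baseChange ℂ w)) a =
      TensorProduct.piScalarRight ℚ ℂ ℂ ι
        (((latticeCoordHOne Φs).toLinearMap ∘ₗ
            (singularCohomology.map ℚ ℚ (us : C(ComplexTorus Φs, ComplexPoints (fiberOver π s.1))) 1).hom).baseChange
          ℂ w) a := by
  classical
  obtain ⟨b, hb⟩ := exists_basis_of_latticeFrame Φs us (γ ⟨s.1, hs⟩) hus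
  have hLs : (latticeCoordHOne Φs).toLinearMap ∘ₗ
      (singularCohomology.map ℚ ℚ (us : C(ComplexTorus Φs, ComplexPoints (fiberOver π s.1))) 1).hom =
        (b.equivFun : _ →ₗ[ℚ] (ι → ℚ)) := by
    refine LinearMap.eq_of_frame b _ _ (fun c ↦ ?_) (fun c ↦ ?_)
    · rw [hb]; exact latticeCoordHOne_map_frame Φs _ (γ ⟨s.1, hs⟩) hus c
    · rw [LinearEquiv.coe_coe, Module.Basis.equivFun_apply, Module.Basis.repr_self, Finsupp.single_eq_pi_single]
  rw [hLs]
  refine piScalarRight_baseChange_comp_of_frame b T (c := γ ⟨t.1, ht⟩) (fun c ↦ ?_) _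
    (fun c ↦ latticeCoordHOne_map_frame Φt ut (γ ⟨t.1, ht⟩) hut c) w a
  rw [hb]
  exact ratTransport_apply_flatFrame π 1 hU hW γ hflat hs ht ε hε T hT c

/-- **(S-4), consumer spelling** (`u_t = e ∘ φ` with the pinned homeomorphism `e : A_t(ℂ) ≃ₜ X_t(ℂ)` of the marked
abelian variety onto the fibre and its uniformisation `φ : ℂ^g/Λ → A_t(ℂ)`; the transported class written as
`(e^* ⊗ ℂ)(T_ℂ w)` — the `hP` matrix of ★ `siegelPoint_eq_of_hodgeFrame_of_apply_jOfSiegel` on the frame of ★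
`hodgeFrame_transport_of_iso`): `P i a = Λ_a (wᵢ)`. [cite: LangeBirkenhake1992, Ch. 8 §8.1] [cite: VoisinHodgeI2002, §9.2.1] -/
theorem latticeCoord_transport_eq_fixedFunctional' {Y : Type} [TopologicalSpace Y]
    (γ : ∀ x : W, ι → singularCohomology ℚ ℚ (ComplexPoints (fiberOver π x.1)) 1)
    (hflat : ∀ (x x' : W) (p : Path.Homotopic.Quotient x x') (a : ι),
      transportFun π 1 hW p (ofRatClass _ 1 (γ x a)) = ofRatClass _ 1 (γ x' a))
    {s t : (Set.univ : Set (ComplexPoints S))} (hs : s.1 ∈ W) (ht : t.1 ∈ W) (ε : Path s t)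
    (hε : ∀ r, (ε r).1 ∈ W)
    (T : singularCohomology ℚ ℚ (ComplexPoints (fiberOver π s.1)) 1 ≃ₗ[ℚ]
      singularCohomology ℚ ℚ (ComplexPoints (fiberOver π t.1)) 1)
    (hT : ∀ v, ofRatClass _ 1 (T v) = transportFun π 1 hU ⟦ε⟧ (ofRatClass _ 1 v))
    {Φs Φt : (ι → ℝ) ≃L[ℝ] E} (us : ComplexTorus Φs ≃ₜ ComplexPoints (fiberOver π s.1))
    (hus : ∀ a, singularCohomology.map ℚ ℚ (us : C(ComplexTorus Φs, ComplexPoints (fiberOver π s.1))) 1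
      (γ ⟨s.1, hs⟩ a) = latticeClass Φs a)
    (e : Y ≃ₜ ComplexPoints (fiberOver π t.1)) (φ : C(ComplexTorus Φt, Y))
    (hut : ∀ a, singularCohomology.map ℚ ℚ ((e : C(Y, ComplexPoints (fiberOver π t.1))).comp φ) 1
      (γ ⟨t.1, ht⟩ a) = latticeClass Φt a)
    (w : ℂ ⊗[ℚ] singularCohomology ℚ ℚ (ComplexPoints (fiberOver π s.1)) 1) (a : ι) :
    TensorProduct.piScalarRight ℚ ℂ ℂ ι
        (((latticeCoordHOne Φt).toLinearMap ∘ₗ (singularCohomology.map ℚ ℚ φ 1).hom).baseChange ℂ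
          ((singularCohomology.map ℚ ℚ (e : C(Y, ComplexPoints (fiberOver π t.1))) 1).hom.baseChange ℂ
            (T.toLinearMap.baseChange ℂ w))) a =
      TensorProduct.piScalarRight ℚ ℂ ℂ ι
        (((latticeCoordHOne Φs).toLinearMap ∘ₗ
            (singularCohomology.map ℚ ℚ (us : C(ComplexTorus Φs, ComplexPoints (fiberOver π s.1))) 1).hom).baseChange
          ℂ w) a := by
  have hcomp : ((latticeCoordHOne Φt).toLinearMap ∘ₗ (singularCohomology.map ℚ ℚ φ 1).hom) ∘ₗ
        (singularCohomology.map ℚ ℚ (e : C(Y, ComplexPoints (fiberOver π t.1))) 1).hom =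
      (latticeCoordHOne Φt).toLinearMap ∘ₗ
        (singularCohomology.map ℚ ℚ ((e : C(Y, ComplexPoints (fiberOver π t.1))).comp φ) 1).hom := by
    rw [singularCohomology.map_comp, ModuleCat.hom_comp, LinearMap.comp_assoc]
  rw [← latticeCoord_transport_eq_fixedFunctional π hU hW γ hflat hs ht ε hε T hT us hus
    ((e : C(Y, ComplexPoints (fiberOver π t.1))).comp φ) hut w a, ← hcomp]
  simp only [LinearMap.baseChange_comp, LinearMap.comp_apply]

end Head

end Literature.AlgebraicGeometry.HodgeTheory

end
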